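import Mathlib.Analysis.InnerProductSpace.Basic
import Mathlib.MeasureTheory.Function.L2Space
import Literature.MathematicalPhysics.QuantumManyBody.PeriodicBoseGasCouplingPath
import Literature.MathematicalPhysics.QuantumManyBody.WeightedCorrector
import HarnessLib

/-!
# The Fubini–Study angle of tagged states is a pseudometric on rays

Topic `Literature/MathematicalPhysics/QuantumManyBody` (companion of `PeriodicBoseGasCouplingPath.lean`,
which defines `taggedInner Ψ Φ = ∫_{cell^{N+1}} conj Ψ · Φ` and `fsAngle Ψ Φ = arccos |⟨Ψ, Φ⟩|`; wanted by
route BECInsertionCorrector, crux `CorrectorClosure`, line `llp-fidelity-arc`, stub `stub_arcChord`).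

* `arccos_norm_inner_le_add_of_norm_eq_one` — in a complex inner product space, for unit vectors
  `x, y, z`: `arccos |⟨x, z⟩| ≤ arccos |⟨x, y⟩| + arccos |⟨y, z⟩|` (the Fubini–Study distance of rays
  satisfies the triangle inequality). Proof: Cauchy–Schwarz for `x - ⟨y,x⟩ y` and `z - ⟨y,z⟩ y` gives
  `|⟨x,z⟩ - ⟨x,y⟩⟨y,z⟩| ≤ √(1-|⟨x,y⟩|²) √(1-|⟨y,z⟩|²)`, i.e. `|⟨x,z⟩| ≥ cos (α + β)` with
  `α = arccos |⟨x,y⟩|`, `β = arccos |⟨y,z⟩|`, and `arccos` is antitone.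
* the `L²(cell^{N+1})` dictionary of tagged states: `TaggedPeriodicTrialState.memLp_two`,
  `TaggedPeriodicTrialState.integral_norm_sq` (`∫ |Ψ|² = 1` as a Bochner integral),
  `TaggedPeriodicTrialState.inner_toLp` (`⟪Ψ, Φ⟫_{L²} = taggedInner Ψ Φ`),
  `TaggedPeriodicTrialState.norm_toLp` (`‖Ψ‖_{L²} = 1`), `taggedInner_self`, `taggedInner_conj`,
  `norm_taggedInner_le_one`;
* `fsAngle_comm`, `fsAngle_self`, and the **triangle inequality** `fsAngle_triangle`.

Mathlib has the triangle inequality for REAL angles between vectors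
(`InnerProductGeometry.angle_le_angle_add_angle`); the ray version (absolute value of a complex inner
product) is proved here directly. [Gu2010, §2] uses this distance for ground-state fidelities.
-/

noncomputable section

open MeasureTheory Filter
open scoped ENNReal NNReal ComplexConjugate InnerProductSpace

namespace Literature.MathematicalPhysics.QuantumManyBody.BoseGas

/-! ## Rays of a complex inner product space -/

section Abstract

variable {E : Type*} [NormedAddCommGroup E] [InnerProductSpace ℂ E]

/-- **Projected Cauchy–Schwarz.** For unit vectors `x, y, z` of a complex inner product space,
`|⟨x, z⟩ - ⟨x, y⟩⟨y, z⟩| ≤ √(1 - |⟨x, y⟩|²) · √(1 - |⟨y, z⟩|²)` (Cauchy–Schwarz for the components of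
`x` and `z` orthogonal to `y`). [folklore] -/
theorem norm_inner_sub_inner_mul_inner_le {x y z : E} (hx : ‖x‖ = 1) (hy : ‖y‖ = 1) (hz : ‖z‖ = 1) :
    ‖⟪x, z⟫_ℂ - ⟪x, y⟫_ℂ * ⟪y, z⟫_ℂ‖ ≤
      Real.sqrt (1 - ‖⟪x, y⟫_ℂ‖ ^ 2) * Real.sqrt (1 - ‖⟪y, z⟫_ℂ‖ ^ 2) := by
  set a : ℂ := ⟪x, y⟫_ℂ with ha
  set b : ℂ := ⟪y, z⟫_ℂ with hb
  have hyx : ⟪y, x⟫_ℂ = conj a := (inner_conj_symm y x).symm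
  have hxx : ⟪x, x⟫_ℂ = 1 := inner_self_eq_one_of_norm_eq_one hx
  have hyy : ⟪y, y⟫_ℂ = 1 := inner_self_eq_one_of_norm_eq_one hy
  have hzz : ⟪z, z⟫_ℂ = 1 := inner_self_eq_one_of_norm_eq_one hz
  set x' : E := x - conj a • y with hx'
  set z' : E := z - b • y with hz'
  -- the inner products of the projected vectors
  have hin : ⟪x', z'⟫_ℂ = ⟪x, z⟫_ℂ - a * b := by
    simp only [hx', hz', inner_sub_left, inner_sub_right, inner_smul_left, inner_smul_right,
      starRingEnd_self_apply, hyy]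
    rw [← ha, ← hb]
    ring
  have hnx : ‖x'‖ ^ 2 = 1 - ‖a‖ ^ 2 := by
    have h1 : ⟪x', x'⟫_ℂ = 1 - conj a * a := by
      simp only [hx', inner_sub_left, inner_sub_right, inner_smul_left, inner_smul_right,
        starRingEnd_self_apply, hyy, hxx, hyx]
      rw [← ha]
      ring
    rw [@norm_sq_eq_re_inner ℂ, h1, Complex.conj_mul', ← Complex.ofReal_pow, ← Complex.ofReal_one,
      ← Complex.ofReal_sub, RCLike.re_to_complex, Complex.ofReal_re]
  have hnz : ‖z'‖ ^ 2 = 1 - ‖b‖ ^ 2 := by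
    have h1 : ⟪z', z'⟫_ℂ = 1 - conj b * b := by
      simp only [hz', inner_sub_left, inner_sub_right, inner_smul_left, inner_smul_right, hyy,
        hzz, ← inner_conj_symm z y]
      rw [← hb]
      ring
    rw [@norm_sq_eq_re_inner ℂ, h1, Complex.conj_mul', ← Complex.ofReal_pow, ← Complex.ofReal_one,
      ← Complex.ofReal_sub, RCLike.re_to_complex, Complex.ofReal_re]
  have hx'n : ‖x'‖ = Real.sqrt (1 - ‖a‖ ^ 2) := by
    rw [← hnx, Real.sqrt_sq (norm_nonneg _)]
  have hz'n : ‖z'‖ = Real.sqrt (1 - ‖b‖ ^ 2) := by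
    rw [← hnz, Real.sqrt_sq (norm_nonneg _)]
  rw [← hin, ← hx'n, ← hz'n]
  exact norm_inner_le_norm x' z'

/-- The trigonometric step: if `0 ≤ A, B ≤ 1` and `A·B - √(1-A²)·√(1-B²) ≤ C`, i.e.
`cos (arccos A + arccos B) ≤ C`, then `arccos C ≤ arccos A + arccos B`. [folklore] -/
theorem arccos_le_arccos_add_arccos {A B C : ℝ} (hA0 : 0 ≤ A) (hA1 : A ≤ 1) (hB0 : 0 ≤ B)
    (hB1 : B ≤ 1) (h : A * B - Real.sqrt (1 - A ^ 2) * Real.sqrt (1 - B ^ 2) ≤ C) :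
    Real.arccos C ≤ Real.arccos A + Real.arccos B := by
  have hcos : Real.cos (Real.arccos A + Real.arccos B) ≤ C := by
    rw [Real.cos_add, Real.cos_arccos (by linarith) hA1, Real.cos_arccos (by linarith) hB1,
      Real.sin_arccos, Real.sin_arccos]
    exact h
  have h0 : 0 ≤ Real.arccos A + Real.arccos B :=
    add_nonneg (Real.arccos_nonneg _) (Real.arccos_nonneg _)
  rcases le_or_gt (Real.arccos A + Real.arccos B) Real.pi with hle | hgt
  · calc Real.arccos C ≤ Real.arccos (Real.cos (Real.arccos A + Real.arccos B)) :=
          Real.arccos_le_arccos hcos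
      _ = Real.arccos A + Real.arccos B := Real.arccos_cos h0 hle
  · exact ((Real.arccos_le_pi C).trans hgt.le)

/-- **Triangle inequality for the Fubini–Study distance of rays.** For unit vectors `x, y, z` of a
complex inner product space, `arccos |⟨x, z⟩| ≤ arccos |⟨x, y⟩| + arccos |⟨y, z⟩|`.
[cite: Gu2010, §2 (fidelity and the Fubini–Study distance)] -/
theorem arccos_norm_inner_le_add_of_norm_eq_one {x y z : E} (hx : ‖x‖ = 1) (hy : ‖y‖ = 1)
    (hz : ‖z‖ = 1) :
    Real.arccos ‖⟪x, z⟫_ℂ‖ ≤ Real.arccos ‖⟪x, y⟫_ℂ‖ + Real.arccos ‖⟪y, z⟫_ℂ‖ := by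
  have hA1 : ‖⟪x, y⟫_ℂ‖ ≤ 1 := by simpa [hx, hy] using norm_inner_le_norm (𝕜 := ℂ) x y
  have hB1 : ‖⟪y, z⟫_ℂ‖ ≤ 1 := by simpa [hy, hz] using norm_inner_le_norm (𝕜 := ℂ) y z
  refine arccos_le_arccos_add_arccos (norm_nonneg _) hA1 (norm_nonneg _) hB1 ?_
  have hkey := norm_inner_sub_inner_mul_inner_le hx hy hz
  have htri : ‖⟪x, y⟫_ℂ * ⟪y, z⟫_ℂ‖ - ‖⟪x, z⟫_ℂ‖ ≤ ‖⟪x, z⟫_ℂ - ⟪x, y⟫_ℂ * ⟪y, z⟫_ℂ‖ := by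
    rw [norm_sub_rev]
    exact norm_sub_norm_le _ _
  rw [norm_mul] at htri
  linarith

end Abstract

/-! ## Tagged states as unit vectors of `L²(cell^{N+1})` -/

variable {N : ℕ} {L : ℝ}

/-- A tagged trial state is square integrable on the fundamental cell (it is continuous and the
cell is bounded). [folklore] -/
theorem TaggedPeriodicTrialState.memLp_two (Ψ : TaggedPeriodicTrialState N L) :
    MemLp Ψ.ψ 2 (volume.restrict (cellN (N + 1) L)) :=
  (memLp_two_iff_integrable_sq_norm Ψ.contDiff.continuous.aestronglyMeasurable).2
    (integrableOn_cellN (Ψ.contDiff.continuous.norm.pow 2) L)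

/-- The normalisation of a tagged state as a Bochner integral: `∫_{cell^{N+1}} |Ψ|² = 1`.
[folklore] -/
theorem TaggedPeriodicTrialState.integral_norm_sq (Ψ : TaggedPeriodicTrialState N L) :
    ∫ X in cellN (N + 1) L, ‖Ψ.ψ X‖ ^ 2 = 1 := by
  have hint : Integrable (fun X => ‖Ψ.ψ X‖ ^ 2) (volume.restrict (cellN (N + 1) L)) :=
    integrableOn_cellN (Ψ.contDiff.continuous.norm.pow 2) L
  have h := ofReal_integral_eq_lintegral_ofReal hint (Eventually.of_forall fun X => by positivity)
  have hpt : ∀ X : Config (N + 1), ENNReal.ofReal (‖Ψ.ψ X‖ ^ 2) = (‖Ψ.ψ X‖₊ : ℝ≥0∞) ^ 2 := fun X => by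
    rw [ENNReal.ofReal_pow (norm_nonneg _), ofReal_norm, enorm_eq_nnnorm]
  simp only [hpt, Ψ.norm_eq] at h
  have h0 : 0 ≤ ∫ X in cellN (N + 1) L, ‖Ψ.ψ X‖ ^ 2 := integral_nonneg fun X => by positivity
  rw [← ENNReal.toReal_ofReal h0, h, ENNReal.toReal_one]

/-- `⟨Ψ, Ψ⟩ = 1`. [folklore] -/
theorem taggedInner_self (Ψ : TaggedPeriodicTrialState N L) : taggedInner Ψ Ψ = 1 := by
  unfold taggedInner
  simp_rw [Complex.conj_mul', ← Complex.ofReal_pow]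
  rw [integral_complex_ofReal, Ψ.integral_norm_sq, Complex.ofReal_one]

/-- `⟨Φ, Ψ⟩ = conj ⟨Ψ, Φ⟩`. [folklore] -/
theorem taggedInner_conj (Ψ Φ : TaggedPeriodicTrialState N L) :
    conj (taggedInner Ψ Φ) = taggedInner Φ Ψ := by
  unfold taggedInner
  rw [← integral_conj]
  refine integral_congr_ae (Eventually.of_forall fun X => ?_)
  simp only [map_mul, starRingEnd_self_apply, mul_comm]

/-- The `L²(cell^{N+1})` inner product of (the classes of) two tagged states is `taggedInner`.
[folklore] -/
theorem TaggedPeriodicTrialState.inner_toLp (Ψ Φ : TaggedPeriodicTrialState N L) :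
    ⟪Ψ.memLp_two.toLp Ψ.ψ, Φ.memLp_two.toLp Φ.ψ⟫_ℂ = taggedInner Ψ Φ := by
  rw [MeasureTheory.L2.inner_def]
  refine integral_congr_ae ?_
  filter_upwards [Ψ.memLp_two.coeFn_toLp, Φ.memLp_two.coeFn_toLp] with X hΨ hΦ
  rw [hΨ, hΦ, RCLike.inner_apply']

/-- A tagged state is a unit vector of `L²(cell^{N+1})`. [folklore] -/
theorem TaggedPeriodicTrialState.norm_toLp (Ψ : TaggedPeriodicTrialState N L) :
    ‖Ψ.memLp_two.toLp Ψ.ψ‖ = 1 := by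
  have h : ‖Ψ.memLp_two.toLp Ψ.ψ‖ ^ 2 = 1 := by
    rw [@norm_sq_eq_re_inner ℂ, Ψ.inner_toLp Ψ, taggedInner_self, RCLike.one_re]
  have h0 : 0 ≤ ‖Ψ.memLp_two.toLp Ψ.ψ‖ := norm_nonneg _
  nlinarith [h, h0]

/-- `|⟨Ψ, Φ⟩| ≤ 1` (Cauchy–Schwarz). [folklore] -/
theorem norm_taggedInner_le_one (Ψ Φ : TaggedPeriodicTrialState N L) : ‖taggedInner Ψ Φ‖ ≤ 1 := by
  rw [← Ψ.inner_toLp Φ]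
  simpa [Ψ.norm_toLp, Φ.norm_toLp] using
    norm_inner_le_norm (𝕜 := ℂ) (Ψ.memLp_two.toLp Ψ.ψ) (Φ.memLp_two.toLp Φ.ψ)

/-! ## The Fubini–Study angle is a pseudometric on tagged states -/

/-- Symmetry: `d(Ψ, Φ) = d(Φ, Ψ)`. [folklore] -/
theorem fsAngle_comm (Ψ Φ : TaggedPeriodicTrialState N L) : fsAngle Ψ Φ = fsAngle Φ Ψ := by
  unfold fsAngle
  rw [← taggedInner_conj Ψ Φ, RCLike.norm_conj]

/-- `d(Ψ, Ψ) = 0`. [folklore] -/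
theorem fsAngle_self (Ψ : TaggedPeriodicTrialState N L) : fsAngle Ψ Ψ = 0 := by
  unfold fsAngle
  rw [taggedInner_self, norm_one, Real.arccos_one]

/-- **Triangle inequality of the Fubini–Study angle**: `d(Ψ, Ξ) ≤ d(Ψ, Φ) + d(Φ, Ξ)` for tagged
trial states (unit vectors of `L²(cell^{N+1})`).
[cite: Gu2010, §2 (fidelity and the Fubini–Study distance)] -/
theorem fsAngle_triangle (Ψ Φ Ξ : TaggedPeriodicTrialState N L) :
    fsAngle Ψ Ξ ≤ fsAngle Ψ Φ + fsAngle Φ Ξ := by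
  unfold fsAngle
  rw [← Ψ.inner_toLp Ξ, ← Ψ.inner_toLp Φ, ← Φ.inner_toLp Ξ]
  exact arccos_norm_inner_le_add_of_norm_eq_one Ψ.norm_toLp Φ.norm_toLp Ξ.norm_toLp

end Literature.MathematicalPhysics.QuantumManyBody.BoseGas

end
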